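import Summits.QuantumFields.YangMills.Theorems.UnitScaleTiltProp7ExactExpansion
import Summits.QuantumFields.YangMills.Theorems.UnitScaleTiltProp7BlendClause1
import HarnessLib

/-!
# Route `UnitScaleTilt`, crux K1 child «MinimiserStabilityRegPr» (stmt-QuantumFields-19200), leaf V3 «Prop 7 from a background (14)», line «blend-l2» —
# THE EXACT PLAQUETTE IDENTITY AT A BACKGROUND, PART 2: THE SUMMED IDENTITY, SUP-FREE QUADRATIC GROWTH, AND THE SUP-FREE CLAUSE-1 SCHEMA

Cell `ym3-torus` ∕ fleet seat `ym-ust-19200-p1` (gen 10; HUMAN RULING D-0037, YM ladder rung R3).  WHY.  Part 1 (`UnitScaleTiltProp7ExactExpansion`) proved,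
per plaquette and with no hypothesis, `¼|U(∂p) − 1|²_HS = ¼|U₀(∂p) − 1|²_HS + ½Re Tr((U₀(∂p)−1)^*(R_p − 1)U₀(∂p)) + ¼|R_p − 1|²_HS` with the RELATIVE plaquette
variable `R_p = U(∂p)U₀(∂p)^*`, and `½Re Tr((U₀(∂p)−1)^*(R_p−1)U₀(∂p)) ≥ Lin_p(Y) − 8a·Σ_{b∈∂p}‖Y_b‖²` against gen 2's exact first-order functional.  Summing
over the plaquettes of the d = 3 carrier (`SU(2)` Wilson action in Hilbert–Schmidt form, incidence `4d = 12`):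
  `A(U) − A(U₀) = Σ_p ½‖R_p − 1‖² + Σ_p ½Re Tr((U₀(∂p)−1)^*(R_p−1)U₀(∂p))`   (EXACT, `wilsonAction4_sub_eq_relPlaq`),
  `Σ_p ½‖R_p − 1‖² − 96a·Σ_b‖Y_b‖² ≤ A(U) − A(U₀) − Lin_{U₀}(Y)`,  `a = εL^{−2(K−n)}`   (`wilsonAction4_sub_ge_relPlaq_T3`),
for a background with plaquettes within `a` of `1` and an ARBITRARY competitor — no sup hypothesis, no `‖Y_b‖ ≤ 1`.  With the RELATIVE-CURVATURE POINCARÉ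
inequality `Σ_b‖Y_b‖² ≤ C_P·L^{2(K−n)}·Σ_p‖R_p − 1‖²` displayed as hypothesis the growth constant is `κ = (1/(2C_P) − 96ε)·L^{−2(K−n)} − C_L`
(`growth_of_relPoincare_T3`) — compare gen 9's `(1/(16C_P))L^{−2(K−n)} − 12(2a² + 128s² + 8a) − C_L` (`Prop7BlendGrowth.growth_of_poincare_T3`), whose `s²`-term
forced the representative's sup to be `≲ L^{−(K−n)}/√C_P`.  The clause-1 schema of gen 9 is re-assembled on this footing: per reading-R2 critical pair ONE
(4)-representative with (ii′) the relative-curvature Poincaré inequality and (iii) the first-variation bound `Lin_U(Y) ≥ −C_L·Σ‖Y‖²` (VERBATIM gen 9's conjunct,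
so the S4 work of the W-seats plugs in unchanged) ⟹ `AtMostOneCriticalOrbit ε₀ V` (`atMostOneCriticalOrbit_of_relSchema_T3`, via gen 6's
`atMostOneCriticalOrbit_of_exists_reprGrowth`); the sup hypothesis (i) and the `s²`-term are gone, so representatives with sup only `O(ε₀)` (the `ℓ²`-optimal
chart `Prop7CompactChart.exists_optimalRepr`) are admissible again, and for a representative with `‖Y_b‖ ≤ s` the hypotheses (ii′) and gen 9's linear-curl
Poincaré (ii) are interchangeable up to `O(s²C_PL^{2(K−n)})`, so nothing is lost for the blended comb gauge (`Prop7BlendedGauge.exists_blendedGauge_T3`).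

WHAT IS PROVED (sorry-free, no definition).  **`wilsonAction4_sub_eq_relPlaq`** (exact, any torus of the tree), **`wilsonAction4_sub_ge_relPlaq_T3`**,
**`growth_of_relPoincare_T3`**, **`atMostOneCriticalOrbit_of_relSchema_T3`**; §5 (v1.1 append) the θ-variant **`growth_of_relPoincare_theta_T3`**,
**`atMostOneCriticalOrbit_of_relSchemaTheta_T3`** (first variation bounded by `−θΣ_p‖R_p − 1‖² − C_LΣ‖Y‖²`, `θ ≤ ½` — the form that survives rough competitors);
§6 (v1.2 append) `linExact_gaugeAct_self_eq` (on the orbit of the background the exact first-order functional is `−Σ½‖R^g_p − 1‖²`).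

HONEST SCOPE.  Bookkeeping over Part 1 and the tree's letters; the relative-curvature Poincaré inequality (ii′) and the first-variation bound (iii) remain the open
analytic inputs of the line (stubs S2/S4 of CARD-19200-V3-g9, in whatever representative they are eventually proved); nothing of [Balaban1985Variational] is
asserted; count-neutral helper toward stmt-QuantumFields-19200 (`--supports`).  Not a claim about the continuum limit or the mass gap.

References: T. Bałaban, CMP 102 (1985) 277–309 [Balaban1985Variational] ((26)–(31) pp.282–283, Prop. 7 p.299, (141)–(143) p.299); CMP 109 (1987) 249–301
[Balaban1987RG1] ((0.14) p.254).
-/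

noncomputable section

open scoped BigOperators Matrix.Norms.L2Operator Matrix

namespace Summit.QuantumFields.YangMills.Theorems.Prop7ExactExpansion

open Literature.MathematicalPhysics.QuantumFieldTheory.Balaban1983to89
open Literature.MathematicalPhysics.QuantumFieldTheory.Balaban1983to89.T3ContinuumYM3Torus
open Literature.MathematicalPhysics.QuantumFieldTheory.Balaban1983to89.T3PrintedRegularMinimiser (RegPr regFibrePr mem_regFibrePr_iff)
open Literature.MathematicalPhysics.QuantumFieldTheory.Balaban1983to89.T3PrintedRegularOrbits (descTransf)
open Literature.MathematicalPhysics.QuantumFieldTheory.Balaban1983to89.T3Thm1Carrier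
open Literature.MathematicalPhysics.QuantumFieldTheory.Balaban1983to89.T3Thm1CarrierNative (IsCritR2)
open Finset
open BlockAveragingEMLLinearisedBackground (pertVar)
open Summit.QuantumFields.YangMills.Theorems.Prop7CovariantCoercivity (sum_norm_sq_coe_sub_one_su2 wilsonAction4_eq_quarter_sum_hs coe_mul_inv_sub_one)
open Summit.QuantumFields.YangMills.Theorems.Prop7FlatLocalMin (sum_plaq_bonds_le)
open Summit.QuantumFields.YangMills.Theorems.Prop7BlendClause1 (pertVar_eq_mul_star plaq_le_of_regPr)
open Summit.QuantumFields.YangMills.Theorems.Prop7CompactChart (atMostOneCriticalOrbit_of_exists_reprGrowth)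

/-! ## §3 Summed: the exact action identity and the sup-free growth inequality at the d = 3 carrier -/

section Action

variable {P : Params} {j : ℕ}

/-- **THE EXACT ACTION IDENTITY AT A BACKGROUND** (`SU(2)`, any torus of the tree): with `R_p = U(∂p)U₀(∂p)^*`,
`A(U) − A(U₀) = Σ_p ½‖R_p − 1‖² + Σ_p ½Re Tr((U₀(∂p) − 1)^*(R_p − 1)U₀(∂p))` — no remainder, no hypothesis. [cite: Balaban1985Variational, (26)-(31) pp.282-283] -/
theorem wilsonAction4_sub_eq_relPlaq (U U₀ : GaugeField P j (Matrix.specialUnitaryGroup (Fin 2) ℂ)) :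
    wilsonAction4 U - wilsonAction4 U₀ = ∑ p : Plaq P j,
      ((1 / 2) * ‖((GaugeField.plaqHol U p : Matrix.specialUnitaryGroup (Fin 2) ℂ) : Matrix (Fin 2) (Fin 2) ℂ)
              * star ((GaugeField.plaqHol U₀ p : Matrix.specialUnitaryGroup (Fin 2) ℂ) : Matrix (Fin 2) (Fin 2) ℂ) - 1‖ ^ 2
        + (1 / 2) * ((((((GaugeField.plaqHol U₀ p : Matrix.specialUnitaryGroup (Fin 2) ℂ) : Matrix (Fin 2) (Fin 2) ℂ)) - 1)ᴴ
            * ((((GaugeField.plaqHol U p : Matrix.specialUnitaryGroup (Fin 2) ℂ) : Matrix (Fin 2) (Fin 2) ℂ)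
                  * star ((GaugeField.plaqHol U₀ p : Matrix.specialUnitaryGroup (Fin 2) ℂ) : Matrix (Fin 2) (Fin 2) ℂ) - 1)
              * ((GaugeField.plaqHol U₀ p : Matrix.specialUnitaryGroup (Fin 2) ℂ) : Matrix (Fin 2) (Fin 2) ℂ))).trace).re) := by
  rw [wilsonAction4_eq_quarter_sum_hs U, wilsonAction4_eq_quarter_sum_hs U₀, ← Finset.sum_sub_distrib]
  refine Finset.sum_congr rfl fun p _ => ?_
  rw [quarter_hs_plaq_eq U U₀ p]
  have hhs : ∑ i₁ : Fin 2, ∑ i₂ : Fin 2, ‖(((GaugeField.plaqHol U p : Matrix.specialUnitaryGroup (Fin 2) ℂ) : Matrix (Fin 2) (Fin 2) ℂ)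
            * star ((GaugeField.plaqHol U₀ p : Matrix.specialUnitaryGroup (Fin 2) ℂ) : Matrix (Fin 2) (Fin 2) ℂ) - 1) i₁ i₂‖ ^ 2
      = 2 * ‖((GaugeField.plaqHol U p : Matrix.specialUnitaryGroup (Fin 2) ℂ) : Matrix (Fin 2) (Fin 2) ℂ)
            * star ((GaugeField.plaqHol U₀ p : Matrix.specialUnitaryGroup (Fin 2) ℂ) : Matrix (Fin 2) (Fin 2) ℂ) - 1‖ ^ 2 := by
    rw [← coe_mul_inv_sub_one]
    exact sum_norm_sq_coe_sub_one_su2 _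
  rw [hhs]
  ring

/-- **THE SUP-FREE LOWER BOUND AT THE d = 3 CARRIER**: background `U₀` with plaquette variables within `a = εL^{−2(K−n)}` of `1` (print's (14), non-strict),
competitor `U` ARBITRARY (`Y_b = U_bU₀,b^* − 1`, no sup hypothesis): `Σ_p ½‖R_p − 1‖² − 96a·Σ_b‖Y_b‖² ≤ A(U) − A(U₀) − Lin_{U₀}(Y)` with gen 2's exact
first-order term `Lin` (the 4th conjunct of `Prop7BlendClause1.atMostOneCriticalOrbit_of_reprSchema_T3`). [cite: Balaban1985Variational, (26)-(31) pp.282-283, (141)-(143) p.299] -/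
theorem wilsonAction4_sub_ge_relPlaq_T3 (F : T3Family) (n K : ℕ)
    (U U₀ : GaugeField (F.P K) 0 (Matrix.specialUnitaryGroup (Fin 2) ℂ)) {ε : ℝ} (hε : 0 ≤ ε)
    (hU₀ : ∀ p : Plaq (F.P K) 0, dist1 (GaugeField.plaqHol U₀ p) ≤ ε * (((F.L : ℝ) ^ (K - n)) ^ 2)⁻¹) :
    ∑ p : Plaq (F.P K) 0, (1 / 2) * ‖((GaugeField.plaqHol U p : Matrix.specialUnitaryGroup (Fin 2) ℂ) : Matrix (Fin 2) (Fin 2) ℂ)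
              * star ((GaugeField.plaqHol U₀ p : Matrix.specialUnitaryGroup (Fin 2) ℂ) : Matrix (Fin 2) (Fin 2) ℂ) - 1‖ ^ 2
        - 96 * (ε * (((F.L : ℝ) ^ (K - n)) ^ 2)⁻¹) * ∑ b : PBond (F.P K) 0, ‖(U b : Matrix (Fin 2) (Fin 2) ℂ) * star (U₀ b : Matrix (Fin 2) (Fin 2) ℂ) - 1‖ ^ 2
      ≤ wilsonAction4 U - wilsonAction4 U₀
        - ∑ p : Plaq (F.P K) 0, (1 / 2) * ((((((GaugeField.plaqHol U₀ p : Matrix.specialUnitaryGroup (Fin 2) ℂ) : Matrix (Fin 2) (Fin 2) ℂ)) - 1)ᴴ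
          * ((((U ⟨p.src, p.μ⟩ : Matrix (Fin 2) (Fin 2) ℂ) * star (U₀ ⟨p.src, p.μ⟩ : Matrix (Fin 2) (Fin 2) ℂ) - 1)
              + (U₀ ⟨p.src, p.μ⟩ : Matrix (Fin 2) (Fin 2) ℂ)
                  * ((U ⟨p.src.shift p.μ, p.ν⟩ : Matrix (Fin 2) (Fin 2) ℂ) * star (U₀ ⟨p.src.shift p.μ, p.ν⟩ : Matrix (Fin 2) (Fin 2) ℂ) - 1)
                  * star (U₀ ⟨p.src, p.μ⟩ : Matrix (Fin 2) (Fin 2) ℂ)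
              - ((U₀ ⟨p.src, p.μ⟩ * U₀ ⟨p.src.shift p.μ, p.ν⟩ * (U₀ ⟨p.src.shift p.ν, p.μ⟩)⁻¹ : Matrix.specialUnitaryGroup (Fin 2) ℂ) : Matrix (Fin 2) (Fin 2) ℂ)
                  * ((U ⟨p.src.shift p.ν, p.μ⟩ : Matrix (Fin 2) (Fin 2) ℂ) * star (U₀ ⟨p.src.shift p.ν, p.μ⟩ : Matrix (Fin 2) (Fin 2) ℂ) - 1)
                  * star ((U₀ ⟨p.src, p.μ⟩ * U₀ ⟨p.src.shift p.μ, p.ν⟩ * (U₀ ⟨p.src.shift p.ν, p.μ⟩)⁻¹ : Matrix.specialUnitaryGroup (Fin 2) ℂ) : Matrix (Fin 2) (Fin 2) ℂ)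
              - ((GaugeField.plaqHol U₀ p : Matrix.specialUnitaryGroup (Fin 2) ℂ) : Matrix (Fin 2) (Fin 2) ℂ)
                  * ((U ⟨p.src, p.ν⟩ : Matrix (Fin 2) (Fin 2) ℂ) * star (U₀ ⟨p.src, p.ν⟩ : Matrix (Fin 2) (Fin 2) ℂ) - 1)
                  * star ((GaugeField.plaqHol U₀ p : Matrix.specialUnitaryGroup (Fin 2) ℂ) : Matrix (Fin 2) (Fin 2) ℂ))
            * ((GaugeField.plaqHol U₀ p : Matrix.specialUnitaryGroup (Fin 2) ℂ) : Matrix (Fin 2) (Fin 2) ℂ))).trace).re := by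
  set a : ℝ := ε * (((F.L : ℝ) ^ (K - n)) ^ 2)⁻¹ with ha_def
  have hL0 : (0 : ℝ) < ((F.L : ℝ) ^ (K - n)) ^ 2 := by
    have : (0 : ℝ) < F.L := by have := F.hL.2; exact_mod_cast (by omega : 0 < F.L)
    positivity
  have ha : 0 ≤ a := mul_nonneg hε (inv_pos.mpr hL0).le
  -- per plaquette, then summed
  have hper := fun p : Plaq (F.P K) 0 => half_re_trace_rel_ge_lin U U₀ p (hU₀ p)
  have hsum := Finset.sum_le_sum fun p (_ : p ∈ (Finset.univ : Finset (Plaq (F.P K) 0))) => hper p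
  rw [Finset.sum_sub_distrib] at hsum
  -- incidence: each bond lies in `4d = 12` plaquette slots
  have hinc := sum_plaq_bonds_le (P := F.P K) (j := 0)
    (fun b => ‖(U b : Matrix (Fin 2) (Fin 2) ℂ) * star (U₀ b : Matrix (Fin 2) (Fin 2) ℂ) - 1‖ ^ 2) (fun b => sq_nonneg _)
  have hd : ((F.P K).d : ℝ) = 3 := by norm_num [T3Family.P_d]
  rw [hd] at hinc
  have herr : ∑ p : Plaq (F.P K) 0, 8 * a
        * (‖(U ⟨p.src, p.μ⟩ : Matrix (Fin 2) (Fin 2) ℂ) * star (U₀ ⟨p.src, p.μ⟩ : Matrix (Fin 2) (Fin 2) ℂ) - 1‖ ^ 2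
            + ‖(U ⟨p.src.shift p.μ, p.ν⟩ : Matrix (Fin 2) (Fin 2) ℂ) * star (U₀ ⟨p.src.shift p.μ, p.ν⟩ : Matrix (Fin 2) (Fin 2) ℂ) - 1‖ ^ 2
            + ‖(U ⟨p.src.shift p.ν, p.μ⟩ : Matrix (Fin 2) (Fin 2) ℂ) * star (U₀ ⟨p.src.shift p.ν, p.μ⟩ : Matrix (Fin 2) (Fin 2) ℂ) - 1‖ ^ 2
            + ‖(U ⟨p.src, p.ν⟩ : Matrix (Fin 2) (Fin 2) ℂ) * star (U₀ ⟨p.src, p.ν⟩ : Matrix (Fin 2) (Fin 2) ℂ) - 1‖ ^ 2)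
      ≤ 96 * a * ∑ b : PBond (F.P K) 0, ‖(U b : Matrix (Fin 2) (Fin 2) ℂ) * star (U₀ b : Matrix (Fin 2) (Fin 2) ℂ) - 1‖ ^ 2 := by
    rw [← Finset.mul_sum]
    have := mul_le_mul_of_nonneg_left hinc (show 0 ≤ 8 * a by positivity)
    linarith [this]
  rw [wilsonAction4_sub_eq_relPlaq U U₀, Finset.sum_add_distrib]
  linarith [hsum, herr]

/-- **QUADRATIC GROWTH FROM THE RELATIVE-CURVATURE POINCARÉ INEQUALITY, SUP-FREE** (d = 3 carrier): background `U₀` with plaquettes within `εL^{−2(K−n)}` of `1`,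
competitor `U` arbitrary; POINCARÉ (ii′): `Σ_b‖Y_b‖² ≤ C_P·L^{2(K−n)}·Σ_p‖R_p − 1‖²`, `R_p = U(∂p)U₀(∂p)^*`.  Then
`((1/(2C_P) − 96ε)·L^{−2(K−n)})·Σ_b‖Y_b‖² ≤ A(U) − A(U₀) − Lin_{U₀}(Y)`. [cite: Balaban1985Variational, (26)-(31) pp.282-283, (141)-(143) p.299] -/
theorem growth_of_relPoincare_T3 (F : T3Family) (n K : ℕ)
    (U U₀ : GaugeField (F.P K) 0 (Matrix.specialUnitaryGroup (Fin 2) ℂ)) {ε CP : ℝ} (hε : 0 ≤ ε) (hCP : 0 < CP)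
    (hU₀ : ∀ p : Plaq (F.P K) 0, dist1 (GaugeField.plaqHol U₀ p) ≤ ε * (((F.L : ℝ) ^ (K - n)) ^ 2)⁻¹)
    (hP : ∑ b : PBond (F.P K) 0, ‖(U b : Matrix (Fin 2) (Fin 2) ℂ) * star (U₀ b : Matrix (Fin 2) (Fin 2) ℂ) - 1‖ ^ 2 ≤
      CP * ((F.L : ℝ) ^ (K - n)) ^ 2 * ∑ p : Plaq (F.P K) 0, ‖((GaugeField.plaqHol U p : Matrix.specialUnitaryGroup (Fin 2) ℂ) : Matrix (Fin 2) (Fin 2) ℂ)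
              * star ((GaugeField.plaqHol U₀ p : Matrix.specialUnitaryGroup (Fin 2) ℂ) : Matrix (Fin 2) (Fin 2) ℂ) - 1‖ ^ 2) :
    ((1 / (2 * CP) - 96 * ε) * (((F.L : ℝ) ^ (K - n)) ^ 2)⁻¹)
        * ∑ b : PBond (F.P K) 0, ‖(U b : Matrix (Fin 2) (Fin 2) ℂ) * star (U₀ b : Matrix (Fin 2) (Fin 2) ℂ) - 1‖ ^ 2
      ≤ wilsonAction4 U - wilsonAction4 U₀
        - ∑ p : Plaq (F.P K) 0, (1 / 2) * ((((((GaugeField.plaqHol U₀ p : Matrix.specialUnitaryGroup (Fin 2) ℂ) : Matrix (Fin 2) (Fin 2) ℂ)) - 1)ᴴ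
          * ((((U ⟨p.src, p.μ⟩ : Matrix (Fin 2) (Fin 2) ℂ) * star (U₀ ⟨p.src, p.μ⟩ : Matrix (Fin 2) (Fin 2) ℂ) - 1)
              + (U₀ ⟨p.src, p.μ⟩ : Matrix (Fin 2) (Fin 2) ℂ)
                  * ((U ⟨p.src.shift p.μ, p.ν⟩ : Matrix (Fin 2) (Fin 2) ℂ) * star (U₀ ⟨p.src.shift p.μ, p.ν⟩ : Matrix (Fin 2) (Fin 2) ℂ) - 1)
                  * star (U₀ ⟨p.src, p.μ⟩ : Matrix (Fin 2) (Fin 2) ℂ)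
              - ((U₀ ⟨p.src, p.μ⟩ * U₀ ⟨p.src.shift p.μ, p.ν⟩ * (U₀ ⟨p.src.shift p.ν, p.μ⟩)⁻¹ : Matrix.specialUnitaryGroup (Fin 2) ℂ) : Matrix (Fin 2) (Fin 2) ℂ)
                  * ((U ⟨p.src.shift p.ν, p.μ⟩ : Matrix (Fin 2) (Fin 2) ℂ) * star (U₀ ⟨p.src.shift p.ν, p.μ⟩ : Matrix (Fin 2) (Fin 2) ℂ) - 1)
                  * star ((U₀ ⟨p.src, p.μ⟩ * U₀ ⟨p.src.shift p.μ, p.ν⟩ * (U₀ ⟨p.src.shift p.ν, p.μ⟩)⁻¹ : Matrix.specialUnitaryGroup (Fin 2) ℂ) : Matrix (Fin 2) (Fin 2) ℂ)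
              - ((GaugeField.plaqHol U₀ p : Matrix.specialUnitaryGroup (Fin 2) ℂ) : Matrix (Fin 2) (Fin 2) ℂ)
                  * ((U ⟨p.src, p.ν⟩ : Matrix (Fin 2) (Fin 2) ℂ) * star (U₀ ⟨p.src, p.ν⟩ : Matrix (Fin 2) (Fin 2) ℂ) - 1)
                  * star ((GaugeField.plaqHol U₀ p : Matrix.specialUnitaryGroup (Fin 2) ℂ) : Matrix (Fin 2) (Fin 2) ℂ))
            * ((GaugeField.plaqHol U₀ p : Matrix.specialUnitaryGroup (Fin 2) ℂ) : Matrix (Fin 2) (Fin 2) ℂ))).trace).re := by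
  have hmain := wilsonAction4_sub_ge_relPlaq_T3 F n K U U₀ hε hU₀
  have hLk : (0 : ℝ) < (F.L : ℝ) ^ (K - n) := by
    have : (0 : ℝ) < F.L := by have := F.hL.2; exact_mod_cast (by omega : 0 < F.L)
    positivity
  -- the Poincaré hypothesis in the form `(1/(2C_P))·L^{−2k}·Σ‖Y‖² ≤ ½Σ‖R − 1‖²`
  have hP' : (1 / (2 * CP)) * (((F.L : ℝ) ^ (K - n)) ^ 2)⁻¹ * ∑ b : PBond (F.P K) 0, ‖(U b : Matrix (Fin 2) (Fin 2) ℂ) * star (U₀ b : Matrix (Fin 2) (Fin 2) ℂ) - 1‖ ^ 2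
      ≤ ∑ p : Plaq (F.P K) 0, (1 / 2) * ‖((GaugeField.plaqHol U p : Matrix.specialUnitaryGroup (Fin 2) ℂ) : Matrix (Fin 2) (Fin 2) ℂ)
              * star ((GaugeField.plaqHol U₀ p : Matrix.specialUnitaryGroup (Fin 2) ℂ) : Matrix (Fin 2) (Fin 2) ℂ) - 1‖ ^ 2 := by
    have e : ∀ S : ℝ, (1 / (2 * CP)) * (((F.L : ℝ) ^ (K - n)) ^ 2)⁻¹ * (CP * ((F.L : ℝ) ^ (K - n)) ^ 2 * S) = (1 / 2) * S := by
      intro S; field_simp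
    have key := mul_le_mul_of_nonneg_left hP (show (0 : ℝ) ≤ (1 / (2 * CP)) * (((F.L : ℝ) ^ (K - n)) ^ 2)⁻¹ by positivity)
    rw [e] at key
    refine key.trans (le_of_eq ?_)
    rw [Finset.mul_sum]
  have e2 : ((1 / (2 * CP) - 96 * ε) * (((F.L : ℝ) ^ (K - n)) ^ 2)⁻¹)
        * ∑ b : PBond (F.P K) 0, ‖(U b : Matrix (Fin 2) (Fin 2) ℂ) * star (U₀ b : Matrix (Fin 2) (Fin 2) ℂ) - 1‖ ^ 2
      = (1 / (2 * CP)) * (((F.L : ℝ) ^ (K - n)) ^ 2)⁻¹ * ∑ b : PBond (F.P K) 0, ‖(U b : Matrix (Fin 2) (Fin 2) ℂ) * star (U₀ b : Matrix (Fin 2) (Fin 2) ℂ) - 1‖ ^ 2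
        - 96 * (ε * (((F.L : ℝ) ^ (K - n)) ^ 2)⁻¹) * ∑ b : PBond (F.P K) 0, ‖(U b : Matrix (Fin 2) (Fin 2) ℂ) * star (U₀ b : Matrix (Fin 2) (Fin 2) ℂ) - 1‖ ^ 2 := by
    ring
  rw [e2]
  linarith [hmain, hP']

end Action

/-! ## §4 Clause 1 at a member and a datum from the sup-free representative schema -/

section Schema

variable (F : T3Family) {n K : ℕ} (h : n ≤ K)

/-- **CLAUSE 1 AT `(V, ε₀)` FROM THE SUP-FREE REPRESENTATIVE SCHEMA.**  If for every pair of reading-R2 critical `U, W ∈ (6)(ε₀) ∩ fibre(V)` there is `g`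
with `g↓ = 1` such that `Y_b = (W^g)_bU_b^* − 1` and the relative plaquette field `R_p = W^g(∂p)U(∂p)^*` satisfy (ii′) the RELATIVE-CURVATURE POINCARÉ
inequality `Σ_b‖Y_b‖² ≤ C_P·L^{2(K−n)}·Σ_p‖R_p − 1‖²` and (iii) the first-variation bound `Lin_U(Y) ≥ −C_L·Σ_b‖Y_b‖²` (verbatim gen 9's conjunct), and if
`κ := (1/(2C_P) − 96ε₀)·L^{−2(K−n)} − C_L > 0`, then any two reading-R2 critical configurations of `(6)(ε₀) ∩ fibre(V)` lie on one orbit of print's group (4).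
No sup hypothesis on the representative. [cite: Balaban1985Variational, Prop. 7 p.299, (141)-(143) p.299] -/
theorem atMostOneCriticalOrbit_of_relSchema_T3 {ε₀ CP CL : ℝ} (hε : 0 ≤ ε₀) (hCP : 0 < CP)
    (V : GaugeField (F.P n) 0 (Matrix.specialUnitaryGroup (Fin 2) ℂ))
    (hκ : 0 < (1 / (2 * CP) - 96 * ε₀) * (((F.L : ℝ) ^ (K - n)) ^ 2)⁻¹ - CL)
    (hrepr : ∀ U W : GaugeField (F.P K) 0 (Matrix.specialUnitaryGroup (Fin 2) ℂ),
      U ∈ regFibrePr F n K h ε₀ V → IsCritR2 F n K h V U → W ∈ regFibrePr F n K h ε₀ V → IsCritR2 F n K h V W →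
        ∃ g : GaugeTransf (F.P K) 0 (Matrix.specialUnitaryGroup (Fin 2) ℂ), descTransf F n K h g = (fun _ => 1) ∧
          (∑ b : PBond (F.P K) 0, ‖pertVar U (GaugeField.gaugeAct g W) b‖ ^ 2 ≤
            CP * ((F.L : ℝ) ^ (K - n)) ^ 2 * ∑ p : Plaq (F.P K) 0,
              ‖((GaugeField.plaqHol (GaugeField.gaugeAct g W) p : Matrix.specialUnitaryGroup (Fin 2) ℂ) : Matrix (Fin 2) (Fin 2) ℂ)
                  * star ((GaugeField.plaqHol U p : Matrix.specialUnitaryGroup (Fin 2) ℂ) : Matrix (Fin 2) (Fin 2) ℂ) - 1‖ ^ 2) ∧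
          (-CL * ∑ b : PBond (F.P K) 0, ‖pertVar U (GaugeField.gaugeAct g W) b‖ ^ 2 ≤
            ∑ p : Plaq (F.P K) 0, (1 / 2) * ((((((GaugeField.plaqHol U p : Matrix.specialUnitaryGroup (Fin 2) ℂ) : Matrix (Fin 2) (Fin 2) ℂ)) - 1)ᴴ
              * (((((GaugeField.gaugeAct g W ⟨p.src, p.μ⟩ : Matrix.specialUnitaryGroup (Fin 2) ℂ) : Matrix (Fin 2) (Fin 2) ℂ) * star (U ⟨p.src, p.μ⟩ : Matrix (Fin 2) (Fin 2) ℂ) - 1)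
                  + (U ⟨p.src, p.μ⟩ : Matrix (Fin 2) (Fin 2) ℂ)
                      * (((GaugeField.gaugeAct g W ⟨p.src.shift p.μ, p.ν⟩ : Matrix.specialUnitaryGroup (Fin 2) ℂ) : Matrix (Fin 2) (Fin 2) ℂ) *
                          star (U ⟨p.src.shift p.μ, p.ν⟩ : Matrix (Fin 2) (Fin 2) ℂ) - 1)
                      * star (U ⟨p.src, p.μ⟩ : Matrix (Fin 2) (Fin 2) ℂ)
                  - ((U ⟨p.src, p.μ⟩ * U ⟨p.src.shift p.μ, p.ν⟩ * (U ⟨p.src.shift p.ν, p.μ⟩)⁻¹ : Matrix.specialUnitaryGroup (Fin 2) ℂ) :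
                        Matrix (Fin 2) (Fin 2) ℂ)
                      * (((GaugeField.gaugeAct g W ⟨p.src.shift p.ν, p.μ⟩ : Matrix.specialUnitaryGroup (Fin 2) ℂ) : Matrix (Fin 2) (Fin 2) ℂ) *
                          star (U ⟨p.src.shift p.ν, p.μ⟩ : Matrix (Fin 2) (Fin 2) ℂ) - 1)
                      * star ((U ⟨p.src, p.μ⟩ * U ⟨p.src.shift p.μ, p.ν⟩ * (U ⟨p.src.shift p.ν, p.μ⟩)⁻¹ : Matrix.specialUnitaryGroup (Fin 2) ℂ) :
                        Matrix (Fin 2) (Fin 2) ℂ)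
                  - ((GaugeField.plaqHol U p : Matrix.specialUnitaryGroup (Fin 2) ℂ) : Matrix (Fin 2) (Fin 2) ℂ)
                      * (((GaugeField.gaugeAct g W ⟨p.src, p.ν⟩ : Matrix.specialUnitaryGroup (Fin 2) ℂ) : Matrix (Fin 2) (Fin 2) ℂ) * star (U ⟨p.src, p.ν⟩ : Matrix (Fin 2) (Fin 2) ℂ) - 1)
                      * star ((GaugeField.plaqHol U p : Matrix.specialUnitaryGroup (Fin 2) ℂ) : Matrix (Fin 2) (Fin 2) ℂ))
                * ((GaugeField.plaqHol U p : Matrix.specialUnitaryGroup (Fin 2) ℂ) : Matrix (Fin 2) (Fin 2) ℂ))).trace).re)) :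
    (varProblem3 F n K h).AtMostOneCriticalOrbit ε₀ V := by
  refine atMostOneCriticalOrbit_of_exists_reprGrowth F h hε V fun U W hU hcU hW hcW => ?_
  obtain ⟨g, hg4, hP, hlin⟩ := hrepr U W hU hcU hW hcW
  refine ⟨g, hg4, _, hκ, ?_⟩
  have hUr : RegPr F n K ε₀ U := ((mem_regFibrePr_iff F).mp hU).2
  have hY : ∀ b : PBond (F.P K) 0, pertVar U (GaugeField.gaugeAct g W) b =
      ((GaugeField.gaugeAct g W b : Matrix.specialUnitaryGroup (Fin 2) ℂ) : Matrix (Fin 2) (Fin 2) ℂ) * star (U b : Matrix (Fin 2) (Fin 2) ℂ) - 1 :=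
    fun b => pertVar_eq_mul_star U (GaugeField.gaugeAct g W) b
  simp only [hY] at hP hlin ⊢
  have hG := growth_of_relPoincare_T3 F n K (GaugeField.gaugeAct g W) U hε hCP (plaq_le_of_regPr F hUr) hP
  rw [sub_mul]
  linarith

end Schema

/-! ## §5 The θ-variant: the first variation measured against the relative curvature (serves rough competitors and row E′) -/

section Theta

variable {P : Params} {j : ℕ}

/-- **QUADRATIC GROWTH WHEN THE FIRST VARIATION IS BOUNDED AGAINST THE RELATIVE CURVATURE** (d = 3 carrier, sup-free): background `U₀` with plaquettes within
`εL^{−2(K−n)}` of `1`, competitor `U` arbitrary; (ii′) `Σ_b‖Y_b‖² ≤ C_P·L^{2(K−n)}·Σ_p‖R_p − 1‖²` and (iii′) `Lin_{U₀}(Y) ≥ −θ·Σ_p‖R_p − 1‖² − C_L·Σ_b‖Y_b‖²` with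
`θ ≤ ½`.  Then `(((½ − θ)/C_P − 96ε)·L^{−2(K−n)} − C_L)·Σ_b‖Y_b‖² ≤ A(U) − A(U₀)`.  (iii′) is the robust form of the first-variation input: for a ROUGH competitor the
pairing `−Σ_cΛ_c·r_c` may reach `O(ε₀L^{−(K−n)})·Σ‖Y‖²` but stays `o(Σ‖R_p − 1‖²)` (route-R card §2(b)); with `θ = ½` (iii′) is free from minimality of `U₀`, the content is `θ < ½`.
[cite: Balaban1985Variational, (26)-(31) pp.282-283, (141)-(143) p.299] -/
theorem growth_of_relPoincare_theta_T3 (F : T3Family) (n K : ℕ)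
    (U U₀ : GaugeField (F.P K) 0 (Matrix.specialUnitaryGroup (Fin 2) ℂ)) {ε CP CL θ : ℝ} (hε : 0 ≤ ε) (hCP : 0 < CP) (hθ : θ ≤ 1 / 2)
    (hU₀ : ∀ p : Plaq (F.P K) 0, dist1 (GaugeField.plaqHol U₀ p) ≤ ε * (((F.L : ℝ) ^ (K - n)) ^ 2)⁻¹)
    (hP : ∑ b : PBond (F.P K) 0, ‖(U b : Matrix (Fin 2) (Fin 2) ℂ) * star (U₀ b : Matrix (Fin 2) (Fin 2) ℂ) - 1‖ ^ 2 ≤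
      CP * ((F.L : ℝ) ^ (K - n)) ^ 2 * ∑ p : Plaq (F.P K) 0, ‖((GaugeField.plaqHol U p : Matrix.specialUnitaryGroup (Fin 2) ℂ) : Matrix (Fin 2) (Fin 2) ℂ)
              * star ((GaugeField.plaqHol U₀ p : Matrix.specialUnitaryGroup (Fin 2) ℂ) : Matrix (Fin 2) (Fin 2) ℂ) - 1‖ ^ 2)
    (hS : -(θ * ∑ p : Plaq (F.P K) 0, ‖((GaugeField.plaqHol U p : Matrix.specialUnitaryGroup (Fin 2) ℂ) : Matrix (Fin 2) (Fin 2) ℂ)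
              * star ((GaugeField.plaqHol U₀ p : Matrix.specialUnitaryGroup (Fin 2) ℂ) : Matrix (Fin 2) (Fin 2) ℂ) - 1‖ ^ 2) - CL * ∑ b : PBond (F.P K) 0, ‖(U b : Matrix (Fin 2) (Fin 2) ℂ) * star (U₀ b : Matrix (Fin 2) (Fin 2) ℂ) - 1‖ ^ 2 ≤
      ∑ p : Plaq (F.P K) 0, (1 / 2) * ((((((GaugeField.plaqHol U₀ p : Matrix.specialUnitaryGroup (Fin 2) ℂ) : Matrix (Fin 2) (Fin 2) ℂ)) - 1)ᴴ
          * ((((U ⟨p.src, p.μ⟩ : Matrix (Fin 2) (Fin 2) ℂ) * star (U₀ ⟨p.src, p.μ⟩ : Matrix (Fin 2) (Fin 2) ℂ) - 1)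
              + (U₀ ⟨p.src, p.μ⟩ : Matrix (Fin 2) (Fin 2) ℂ)
                  * ((U ⟨p.src.shift p.μ, p.ν⟩ : Matrix (Fin 2) (Fin 2) ℂ) * star (U₀ ⟨p.src.shift p.μ, p.ν⟩ : Matrix (Fin 2) (Fin 2) ℂ) - 1)
                  * star (U₀ ⟨p.src, p.μ⟩ : Matrix (Fin 2) (Fin 2) ℂ)
              - ((U₀ ⟨p.src, p.μ⟩ * U₀ ⟨p.src.shift p.μ, p.ν⟩ * (U₀ ⟨p.src.shift p.ν, p.μ⟩)⁻¹ : Matrix.specialUnitaryGroup (Fin 2) ℂ) : Matrix (Fin 2) (Fin 2) ℂ)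
                  * ((U ⟨p.src.shift p.ν, p.μ⟩ : Matrix (Fin 2) (Fin 2) ℂ) * star (U₀ ⟨p.src.shift p.ν, p.μ⟩ : Matrix (Fin 2) (Fin 2) ℂ) - 1)
                  * star ((U₀ ⟨p.src, p.μ⟩ * U₀ ⟨p.src.shift p.μ, p.ν⟩ * (U₀ ⟨p.src.shift p.ν, p.μ⟩)⁻¹ : Matrix.specialUnitaryGroup (Fin 2) ℂ) : Matrix (Fin 2) (Fin 2) ℂ)
              - ((GaugeField.plaqHol U₀ p : Matrix.specialUnitaryGroup (Fin 2) ℂ) : Matrix (Fin 2) (Fin 2) ℂ)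
                  * ((U ⟨p.src, p.ν⟩ : Matrix (Fin 2) (Fin 2) ℂ) * star (U₀ ⟨p.src, p.ν⟩ : Matrix (Fin 2) (Fin 2) ℂ) - 1)
                  * star ((GaugeField.plaqHol U₀ p : Matrix.specialUnitaryGroup (Fin 2) ℂ) : Matrix (Fin 2) (Fin 2) ℂ))
            * ((GaugeField.plaqHol U₀ p : Matrix.specialUnitaryGroup (Fin 2) ℂ) : Matrix (Fin 2) (Fin 2) ℂ))).trace).re) :
    (((1 / 2 - θ) / CP - 96 * ε) * (((F.L : ℝ) ^ (K - n)) ^ 2)⁻¹ - CL) * ∑ b : PBond (F.P K) 0, ‖(U b : Matrix (Fin 2) (Fin 2) ℂ) * star (U₀ b : Matrix (Fin 2) (Fin 2) ℂ) - 1‖ ^ 2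
      ≤ wilsonAction4 U - wilsonAction4 U₀ := by
  have hmain := wilsonAction4_sub_ge_relPlaq_T3 F n K U U₀ hε hU₀
  have hLk : (0 : ℝ) < ((F.L : ℝ) ^ (K - n)) ^ 2 := by
    have : (0 : ℝ) < F.L := by have := F.hL.2; exact_mod_cast (by omega : 0 < F.L)
    positivity
  -- the Poincaré hypothesis in the form `((½ − θ)/C_P)·L^{−2k}·Σ‖Y‖² ≤ (½ − θ)·Σ‖R − 1‖²`
  have hP' : ((1 / 2 - θ) / CP) * (((F.L : ℝ) ^ (K - n)) ^ 2)⁻¹ * ∑ b : PBond (F.P K) 0, ‖(U b : Matrix (Fin 2) (Fin 2) ℂ) * star (U₀ b : Matrix (Fin 2) (Fin 2) ℂ) - 1‖ ^ 2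
      ≤ (1 / 2 - θ) * ∑ p : Plaq (F.P K) 0, ‖((GaugeField.plaqHol U p : Matrix.specialUnitaryGroup (Fin 2) ℂ) : Matrix (Fin 2) (Fin 2) ℂ)
              * star ((GaugeField.plaqHol U₀ p : Matrix.specialUnitaryGroup (Fin 2) ℂ) : Matrix (Fin 2) (Fin 2) ℂ) - 1‖ ^ 2 := by
    have e : ∀ S : ℝ, ((1 / 2 - θ) / CP) * (((F.L : ℝ) ^ (K - n)) ^ 2)⁻¹ * (CP * ((F.L : ℝ) ^ (K - n)) ^ 2 * S) = (1 / 2 - θ) * S := by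
      intro S
      have hCP0 : CP ≠ 0 := hCP.ne'
      have hL0 : ((F.L : ℝ) ^ (K - n)) ^ 2 ≠ 0 := hLk.ne'
      calc ((1 / 2 - θ) / CP) * (((F.L : ℝ) ^ (K - n)) ^ 2)⁻¹ * (CP * ((F.L : ℝ) ^ (K - n)) ^ 2 * S)
          = (1 / 2 - θ) * S * ((CP / CP) * ((((F.L : ℝ) ^ (K - n)) ^ 2)⁻¹ * ((F.L : ℝ) ^ (K - n)) ^ 2)) := by ring
        _ = (1 / 2 - θ) * S := by rw [div_self hCP0, inv_mul_cancel₀ hL0]; ring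
    have key := mul_le_mul_of_nonneg_left hP (show (0 : ℝ) ≤ ((1 / 2 - θ) / CP) * (((F.L : ℝ) ^ (K - n)) ^ 2)⁻¹ by
      have : 0 ≤ 1 / 2 - θ := by linarith
      positivity)
    rw [e] at key
    exact key
  have e1 : ∑ p : Plaq (F.P K) 0, (1 / 2) * ‖((GaugeField.plaqHol U p : Matrix.specialUnitaryGroup (Fin 2) ℂ) : Matrix (Fin 2) (Fin 2) ℂ)
              * star ((GaugeField.plaqHol U₀ p : Matrix.specialUnitaryGroup (Fin 2) ℂ) : Matrix (Fin 2) (Fin 2) ℂ) - 1‖ ^ 2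
      = (1 / 2) * ∑ p : Plaq (F.P K) 0, ‖((GaugeField.plaqHol U p : Matrix.specialUnitaryGroup (Fin 2) ℂ) : Matrix (Fin 2) (Fin 2) ℂ)
              * star ((GaugeField.plaqHol U₀ p : Matrix.specialUnitaryGroup (Fin 2) ℂ) : Matrix (Fin 2) (Fin 2) ℂ) - 1‖ ^ 2 := by
    rw [Finset.mul_sum]
  have e2 : (((1 / 2 - θ) / CP - 96 * ε) * (((F.L : ℝ) ^ (K - n)) ^ 2)⁻¹ - CL) * ∑ b : PBond (F.P K) 0, ‖(U b : Matrix (Fin 2) (Fin 2) ℂ) * star (U₀ b : Matrix (Fin 2) (Fin 2) ℂ) - 1‖ ^ 2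
      = ((1 / 2 - θ) / CP) * (((F.L : ℝ) ^ (K - n)) ^ 2)⁻¹ * ∑ b : PBond (F.P K) 0, ‖(U b : Matrix (Fin 2) (Fin 2) ℂ) * star (U₀ b : Matrix (Fin 2) (Fin 2) ℂ) - 1‖ ^ 2
        - 96 * (ε * (((F.L : ℝ) ^ (K - n)) ^ 2)⁻¹) * ∑ b : PBond (F.P K) 0, ‖(U b : Matrix (Fin 2) (Fin 2) ℂ) * star (U₀ b : Matrix (Fin 2) (Fin 2) ℂ) - 1‖ ^ 2
        - CL * ∑ b : PBond (F.P K) 0, ‖(U b : Matrix (Fin 2) (Fin 2) ℂ) * star (U₀ b : Matrix (Fin 2) (Fin 2) ℂ) - 1‖ ^ 2 := by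
    ring
  rw [e2]
  rw [e1] at hmain
  linarith [hmain, hP', hS]

variable (F : T3Family) {n K : ℕ} (h : n ≤ K)

/-- **CLAUSE 1 AT `(V, ε₀)` FROM THE θ-VARIANT OF THE SUP-FREE SCHEMA**: per pair of reading-R2 critical `U, W ∈ (6)(ε₀) ∩ fibre(V)` ONE `g` with `g↓ = 1` such that
`Y = (W^g)U^* − 1` and `R_p = W^g(∂p)U(∂p)^*` satisfy (ii′) the relative-curvature Poincaré inequality and (iii′) `Lin_U(Y) ≥ −θ·Σ_p‖R_p − 1‖² − C_L·Σ_b‖Y_b‖²`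
(`θ ≤ ½`); if `κ := ((½ − θ)/C_P − 96ε₀)·L^{−2(K−n)} − C_L > 0` then any two reading-R2 critical configurations of `(6)(ε₀) ∩ fibre(V)` lie on one orbit of print's
group (4). [cite: Balaban1985Variational, Prop. 7 p.299, (141)-(143) p.299] -/
theorem atMostOneCriticalOrbit_of_relSchemaTheta_T3 {ε₀ CP CL θ : ℝ} (hε : 0 ≤ ε₀) (hCP : 0 < CP) (hθ : θ ≤ 1 / 2)
    (V : GaugeField (F.P n) 0 (Matrix.specialUnitaryGroup (Fin 2) ℂ))
    (hκ : 0 < ((1 / 2 - θ) / CP - 96 * ε₀) * (((F.L : ℝ) ^ (K - n)) ^ 2)⁻¹ - CL)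
    (hrepr : ∀ U W : GaugeField (F.P K) 0 (Matrix.specialUnitaryGroup (Fin 2) ℂ),
      U ∈ regFibrePr F n K h ε₀ V → IsCritR2 F n K h V U → W ∈ regFibrePr F n K h ε₀ V → IsCritR2 F n K h V W →
        ∃ g : GaugeTransf (F.P K) 0 (Matrix.specialUnitaryGroup (Fin 2) ℂ), descTransf F n K h g = (fun _ => 1) ∧
          (∑ b : PBond (F.P K) 0, ‖pertVar U (GaugeField.gaugeAct g W) b‖ ^ 2 ≤
            CP * ((F.L : ℝ) ^ (K - n)) ^ 2 * ∑ p : Plaq (F.P K) 0,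
              ‖((GaugeField.plaqHol (GaugeField.gaugeAct g W) p : Matrix.specialUnitaryGroup (Fin 2) ℂ) : Matrix (Fin 2) (Fin 2) ℂ)
                  * star ((GaugeField.plaqHol U p : Matrix.specialUnitaryGroup (Fin 2) ℂ) : Matrix (Fin 2) (Fin 2) ℂ) - 1‖ ^ 2) ∧
          (-(θ * ∑ p : Plaq (F.P K) 0,
              ‖((GaugeField.plaqHol (GaugeField.gaugeAct g W) p : Matrix.specialUnitaryGroup (Fin 2) ℂ) : Matrix (Fin 2) (Fin 2) ℂ)
                  * star ((GaugeField.plaqHol U p : Matrix.specialUnitaryGroup (Fin 2) ℂ) : Matrix (Fin 2) (Fin 2) ℂ) - 1‖ ^ 2)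
              - CL * ∑ b : PBond (F.P K) 0, ‖pertVar U (GaugeField.gaugeAct g W) b‖ ^ 2 ≤
            ∑ p : Plaq (F.P K) 0, (1 / 2) * ((((((GaugeField.plaqHol U p : Matrix.specialUnitaryGroup (Fin 2) ℂ) : Matrix (Fin 2) (Fin 2) ℂ)) - 1)ᴴ
          * (((((GaugeField.gaugeAct g W ⟨p.src, p.μ⟩ : Matrix.specialUnitaryGroup (Fin 2) ℂ) : Matrix (Fin 2) (Fin 2) ℂ) * star (U ⟨p.src, p.μ⟩ : Matrix (Fin 2) (Fin 2) ℂ) - 1)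
              + (U ⟨p.src, p.μ⟩ : Matrix (Fin 2) (Fin 2) ℂ)
                  * (((GaugeField.gaugeAct g W ⟨p.src.shift p.μ, p.ν⟩ : Matrix.specialUnitaryGroup (Fin 2) ℂ) : Matrix (Fin 2) (Fin 2) ℂ) * star (U ⟨p.src.shift p.μ, p.ν⟩ : Matrix (Fin 2) (Fin 2) ℂ) - 1)
                  * star (U ⟨p.src, p.μ⟩ : Matrix (Fin 2) (Fin 2) ℂ)
              - ((U ⟨p.src, p.μ⟩ * U ⟨p.src.shift p.μ, p.ν⟩ * (U ⟨p.src.shift p.ν, p.μ⟩)⁻¹ : Matrix.specialUnitaryGroup (Fin 2) ℂ) : Matrix (Fin 2) (Fin 2) ℂ)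
                  * (((GaugeField.gaugeAct g W ⟨p.src.shift p.ν, p.μ⟩ : Matrix.specialUnitaryGroup (Fin 2) ℂ) : Matrix (Fin 2) (Fin 2) ℂ) * star (U ⟨p.src.shift p.ν, p.μ⟩ : Matrix (Fin 2) (Fin 2) ℂ) - 1)
                  * star ((U ⟨p.src, p.μ⟩ * U ⟨p.src.shift p.μ, p.ν⟩ * (U ⟨p.src.shift p.ν, p.μ⟩)⁻¹ : Matrix.specialUnitaryGroup (Fin 2) ℂ) : Matrix (Fin 2) (Fin 2) ℂ)
              - ((GaugeField.plaqHol U p : Matrix.specialUnitaryGroup (Fin 2) ℂ) : Matrix (Fin 2) (Fin 2) ℂ)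
                  * (((GaugeField.gaugeAct g W ⟨p.src, p.ν⟩ : Matrix.specialUnitaryGroup (Fin 2) ℂ) : Matrix (Fin 2) (Fin 2) ℂ) * star (U ⟨p.src, p.ν⟩ : Matrix (Fin 2) (Fin 2) ℂ) - 1)
                  * star ((GaugeField.plaqHol U p : Matrix.specialUnitaryGroup (Fin 2) ℂ) : Matrix (Fin 2) (Fin 2) ℂ))
            * ((GaugeField.plaqHol U p : Matrix.specialUnitaryGroup (Fin 2) ℂ) : Matrix (Fin 2) (Fin 2) ℂ))).trace).re)) :
    (varProblem3 F n K h).AtMostOneCriticalOrbit ε₀ V := by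
  refine atMostOneCriticalOrbit_of_exists_reprGrowth F h hε V fun U W hU hcU hW hcW => ?_
  obtain ⟨g, hg4, hP, hlin⟩ := hrepr U W hU hcU hW hcW
  refine ⟨g, hg4, _, hκ, ?_⟩
  have hUr : RegPr F n K ε₀ U := ((mem_regFibrePr_iff F).mp hU).2
  have hY : ∀ b : PBond (F.P K) 0, pertVar U (GaugeField.gaugeAct g W) b =
      ((GaugeField.gaugeAct g W b : Matrix.specialUnitaryGroup (Fin 2) ℂ) : Matrix (Fin 2) (Fin 2) ℂ) * star (U b : Matrix (Fin 2) (Fin 2) ℂ) - 1 :=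
    fun b => pertVar_eq_mul_star U (GaugeField.gaugeAct g W) b
  simp only [hY] at hP hlin ⊢
  exact growth_of_relPoincare_theta_T3 F n K (GaugeField.gaugeAct g W) U hε hCP hθ (plaq_le_of_regPr F hUr) hP hlin

end Theta

/-! ## §6 On one orbit the exact first-order functional is minus the whole relative-curvature term (the first variation is second-order sensitive to the representative) -/

section Orbit

variable {P : Params} {j : ℕ}

/-- **AT THE TRIVIAL PAIR `W = U`, FOR ANY GAUGE TRANSFORMATION `g` (pinned or not):**
`Σ_p ½Re Tr((U(∂p) − 1)^*(R^g_p − 1)U(∂p)) = −Σ_p ½‖R^g_p − 1‖²`, `R^g_p = U^g(∂p)U(∂p)^*` — the exact identity `wilsonAction4_sub_eq_relPlaq` at the pair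
`(U^g, U)` plus gauge invariance `A(U^g) = A(U)`.  So the exact first-order functional of gen 2∕gen 10 is as negative as the relative-curvature term is positive on
the orbit of the background: the first-variation input of the schemas (stub S of route-R) is a property of the CHOSEN representative, not of the orbit (route-R card
§2(b)). [cite: Balaban1985Variational, (26)-(31) pp.282-283, (4) p.278] -/
theorem linExact_gaugeAct_self_eq (U : GaugeField P j (Matrix.specialUnitaryGroup (Fin 2) ℂ)) (g : GaugeTransf P j (Matrix.specialUnitaryGroup (Fin 2) ℂ)) :
    ∑ p : Plaq P j, (1 / 2) * ((((((GaugeField.plaqHol U p : Matrix.specialUnitaryGroup (Fin 2) ℂ) : Matrix (Fin 2) (Fin 2) ℂ)) - 1)ᴴ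
            * ((((GaugeField.plaqHol (GaugeField.gaugeAct g U) p : Matrix.specialUnitaryGroup (Fin 2) ℂ) : Matrix (Fin 2) (Fin 2) ℂ)
                  * star ((GaugeField.plaqHol U p : Matrix.specialUnitaryGroup (Fin 2) ℂ) : Matrix (Fin 2) (Fin 2) ℂ) - 1)
              * ((GaugeField.plaqHol U p : Matrix.specialUnitaryGroup (Fin 2) ℂ) : Matrix (Fin 2) (Fin 2) ℂ))).trace).re
      = -∑ p : Plaq P j, (1 / 2) * ‖((GaugeField.plaqHol (GaugeField.gaugeAct g U) p : Matrix.specialUnitaryGroup (Fin 2) ℂ) : Matrix (Fin 2) (Fin 2) ℂ)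
              * star ((GaugeField.plaqHol U p : Matrix.specialUnitaryGroup (Fin 2) ℂ) : Matrix (Fin 2) (Fin 2) ℂ) - 1‖ ^ 2 := by
  have h := wilsonAction4_sub_eq_relPlaq (GaugeField.gaugeAct g U) U
  rw [show wilsonAction4 (GaugeField.gaugeAct g U) = wilsonAction4 U from T4WilsonGaugeFlatDirection.wilsonAction_gaugeAct 1 g U, sub_self,
    Finset.sum_add_distrib] at h
  linarith

end Orbit

end Summit.QuantumFields.YangMills.Theorems.Prop7ExactExpansion

end
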